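import Mathlib
import HarnessLib
import Literature.Analysis.FluidPDE.TypeIAncientMild
import Literature.Analysis.FluidPDE.NSLerayOseenRepresentation
import Literature.Analysis.FluidPDE.LerayVolterraComparison
import Summits.NavierStokesRegularity.NavierStokesRegularity.Theorems.QuarterLogPincerThinCascadeDefs

/-!
# Crux `QuarterLogPincer.TypeIQuantSubcubicExp` (stmt-NavierStokesRegularity-24077), EDGE line `truncation_edge`
  (ns-idea-7 g8, `Cruxes/TypeIQuantSubcubicExp/Lines/truncation_edge.lean` v1.1 `dca6249ee423`):
  obligation **T4 — Leray's rate floor at a singular apex, in the KNSS gauge**, PROVED (def body unfolded)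

Prover file (nsreg-C26-p1 g7, DIRECTOR-NS #259 (2); `--supports stmt-NavierStokesRegularity-24077`, helper).
The line's obligation T4 `stub_rateFloor : StubRateFloor` reads: a Type-I ancient mild field `v` in the KNSS/Oseen gauge
(`IsTypeIAncientMild M v`) which is singular at the space–time origin (`SingularAt v 0`: unbounded on every backward
parabolic neighbourhood `B_r(0) × (−r², 0)`) obeys Leray's floor `sup_x ‖v(s,x)‖ ≥ c/√(−s)`, attained at a point, for
every `s ∈ [−1, 0)` (`RateFloor v`).  This file proves it with the body of `RateFloor` UNFOLDED
(`rateFloor_of_isTypeIAncientMild_of_singularAt`), with the UNIVERSAL constant `c = (16 C₁)⁻¹`, `C₁` the constant of the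
weighted Oseen–Duhamel bound (`exists_enorm_oseenDuhamel_weighted_le`); the by-name one-liner follows in a separate file
once the line's Defs module is in the tree.

THE ARGUMENT (Leray 1934 §19 (3.9) / §21 (3.14)–(3.15), transplanted from the tree's finite-energy version
`exists_norm_le_const_add_volterra` / `exists_norm_le_two_mul_of_window` (`NSLerayBlowupRateTopHolds.lean`) to the KNSS gauge,
where the mild identity `v(t) = e^{(t−s)Δ}v(s) − B¹_s(v,v)(t)` between all negative times is PART OF THE CLASS, so no
representation theorem is needed):
* `norm_le_const_add_volterra_of_mild` — for a field `w` on `[0,T₁] × ℝ³` with `w(s) = e^{sΔ}w(0) − B¹_0(w,w)(s)`,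
  `‖w(0)‖ ≤ V₀` and a measurable majorant `V` of the slices: `‖w(s,x)‖ ≤ V₀ + C₁ ∫₀ˢ (s−τ)^{−1/2} V(τ)² dτ`
  (maximum principle for the caloric part + the weighted Duhamel bound);
* `norm_le_two_mul_of_window_of_mild` — hence `‖w(t,x)‖ ≤ 2V₀` on the window `64 C₁² V₀² t < 1` (lower-semicontinuous
  sup norm + Ożański–Pooley's comparison principle `volterra_sqrt_comparison`, verbatim the tree's route);
* `rateFloor_of_isTypeIAncientMild_of_singularAt` — if `‖v(s₀,·)‖ < c/√(−s₀) =: V₀` everywhere, the window covers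
  `(s₀, 0)` (`64C₁²V₀²(−s₀) = 1/4`), so `‖v‖ ≤ 2V₀` on `(s₀,0) × ℝ³` (translate `w(τ) = v(τ+s₀)`,
  `oseenDuhamel_comp_sub_right`), contradicting `SingularAt v 0` with `r = √(−s₀)`.

HONEST FRAME: a lemma about HYPOTHETICAL singular Type-I ancient mild fields (the objects the line's edge feeds to the crux);
the crux 24077, the input T1, the wall 22144 / W7 and Navier–Stokes regularity are OPEN / not proved.  Statement text of T4
by ns-idea-7 g8 (verbatim body).
-/

noncomputable section

-- the summit-side namespace repeats a component by design (D-0017)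
set_option linter.dupNamespace false

namespace Summit.NavierStokesRegularity.NavierStokesRegularity.Cruxes.TypeIQuantSubcubicExp.TruncationEdge

open MeasureTheory Set Function Metric Filter Topology TopologicalSpace
open scoped ENNReal NNReal
open Literature.Analysis Literature.Analysis.FluidPDE
open Summit.NavierStokesRegularity.NavierStokesRegularity.Cruxes.TypeIQuantSubcubicExp.ThinCascade (SingularAt)

/-! ### Leray's Volterra inequality for a mild field from time `0` (unit viscosity) -/

/-- **Leray's integral inequality (3.5) for an Oseen-mild field from time `0`, unit viscosity.**  There is a universal
`C₁ > 0` such that: if `w(s,x) = e^{sΔ}w(0)(x) − B¹_0(w,w)(s)(x)` for `s ∈ (0,T₁]`, the slices are majorised by a measurable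
`V` with `0 ≤ V ≤ M` (`‖w(τ,y)‖ ≤ V(τ)` on `[0,T₁]`) and `‖w(0,y)‖ ≤ V₀`, then
`‖w(s,x)‖ ≤ V₀ + C₁ ∫_{(0,s)} (s−τ)^{−1/2} V(τ)² dτ` for `s ∈ (0,T₁]`.  (Twin of the tree's
`exists_norm_le_const_add_volterra`, with the representation formula now a hypothesis.)
[cite: Leray1934, §17 (3.5) p. 221] [cite: OzanskiPooley2018, (6.65) with Lemma 6.9 (i)] -/
theorem norm_le_const_add_volterra_of_mild :
    ∃ C₁ : ℝ, 0 < C₁ ∧ ∀ {T₁ M V₀ : ℝ}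
      {w : ℝ → EuclideanSpace ℝ (Fin 3) → EuclideanSpace ℝ (Fin 3)} {V : ℝ → ℝ},
      0 < T₁ →
      (∀ s ∈ Ioc 0 T₁, ∀ x, w s x =
        UnboundedOperators.heatExtension (w 0) s x - oseenDuhamel 1 0 w w s x) →
      0 < M → Measurable V → (∀ τ, 0 ≤ V τ) → (∀ τ, V τ ≤ M) →
      (∀ τ ∈ Icc 0 T₁, ∀ y, ‖w τ y‖ ≤ V τ) →
      (∀ y, ‖w 0 y‖ ≤ V₀) →
      ∀ s ∈ Ioc 0 T₁, ∀ x,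
        ‖w s x‖ ≤ V₀ + C₁ * ∫ τ in Ioo 0 s, (s - τ) ^ (-(1 / 2 : ℝ)) * V τ ^ 2 := by
  -- adapted from Literature/Analysis/FluidPDE/NSLerayBlowupRateTopHolds.lean (`exists_norm_le_const_add_volterra`)
  obtain ⟨C₁, hC₁, hDuh⟩ := exists_enorm_oseenDuhamel_weighted_le (E := EuclideanSpace ℝ (Fin 3))
  refine ⟨C₁, hC₁, ?_⟩
  intro T₁ M V₀ w V hT₁ hmild hM hVm hV0 hVM hVu hV₀ s hs x
  have hs0 : 0 < s := hs.1
  -- ### the heat term: maximum principle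
  have hheat : ‖UnboundedOperators.heatExtension (w 0) s x‖ ≤ V₀ :=
    UnboundedOperators.norm_heatExtension_le hV₀ hs0 x
  -- ### the Duhamel term
  have hI0 : 0 ≤ ∫ τ in Ioo 0 s, (s - τ) ^ (-(1 / 2 : ℝ)) * V τ ^ 2 :=
    setIntegral_nonneg measurableSet_Ioo fun τ hτ =>
      mul_nonneg (Real.rpow_nonneg (sub_nonneg.2 hτ.2.le) _) (sq_nonneg _)
  have hB : ‖oseenDuhamel 1 0 w w s x‖ ≤
      C₁ * ∫ τ in Ioo 0 s, (s - τ) ^ (-(1 / 2 : ℝ)) * V τ ^ 2 := by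
    have hVu' : ∀ τ ∈ Ioo 0 s, ∀ z, ‖w τ z‖ ≤ V τ := fun τ hτ z =>
      hVu τ ⟨hτ.1.le, hτ.2.le.trans hs.2⟩ z
    have h1 := hDuh one_pos (u := w) (v := w) (s := 0) (t := s) (V := V) (fun τ _ => hV0 τ) hVu' hVu' x
    have hEq : EqOn (fun τ => C₁ * V τ ^ 2 * (1 * (s - τ)) ^ (-(1 / 2 : ℝ)))
        (fun τ => C₁ * ((s - τ) ^ (-(1 / 2 : ℝ)) * V τ ^ 2)) (Ioo 0 s) := by
      intro τ _
      show C₁ * V τ ^ 2 * (1 * (s - τ)) ^ (-(1 / 2 : ℝ)) = C₁ * ((s - τ) ^ (-(1 / 2 : ℝ)) * V τ ^ 2)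
      rw [one_mul]
      ring
    have hkern : IntegrableOn (fun τ => (s - τ) ^ (-(1 / 2 : ℝ)) * V τ ^ 2) (Ioo 0 s) := by
      refine Integrable.mul_bdd (c := M ^ 2) (integrableOn_sub_rpow_Ioo (by norm_num))
        ((hVm.pow_const 2).aestronglyMeasurable) (Eventually.of_forall fun τ => ?_)
      rw [Real.norm_of_nonneg (sq_nonneg _)]
      exact pow_le_pow_left₀ (hV0 τ) (hVM τ) 2
    have hint : IntegrableOn (fun τ => C₁ * V τ ^ 2 * (1 * (s - τ)) ^ (-(1 / 2 : ℝ))) (Ioo 0 s) :=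
      IntegrableOn.congr_fun (hkern.const_mul C₁) hEq.symm measurableSet_Ioo
    have hnn : 0 ≤ᵐ[volume.restrict (Ioo 0 s)]
        fun τ => C₁ * V τ ^ 2 * (1 * (s - τ)) ^ (-(1 / 2 : ℝ)) := by
      refine (ae_restrict_iff' measurableSet_Ioo).2 (Eventually.of_forall fun τ hτ => ?_)
      show (0 : ℝ) ≤ C₁ * V τ ^ 2 * (1 * (s - τ)) ^ (-(1 / 2 : ℝ))
      exact mul_nonneg (mul_nonneg hC₁.le (sq_nonneg _))
        (Real.rpow_nonneg (by rw [one_mul]; exact sub_nonneg.2 hτ.2.le) _)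
    rw [← ofReal_integral_eq_lintegral_ofReal hint hnn, setIntegral_congr_fun measurableSet_Ioo hEq,
      integral_const_mul, ← ofReal_norm, ENNReal.ofReal_le_ofReal_iff (mul_nonneg hC₁.le hI0)] at h1
    exact h1
  -- ### assemble
  rw [hmild s hs x]
  exact (norm_sub_le _ _).trans (add_le_add hheat hB)

/-! ### Leray's a priori doubling bound on the window -/

/-- **Leray's (3.15) for an Oseen-mild field from time `0`, unit viscosity**: with the constant `C₁` of
`norm_le_const_add_volterra_of_mild`, if `w` is jointly continuous on `[0,T₁] × ℝ³`, Oseen-mild from time `0`, bounded by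
`M` there and `‖w(0,y)‖ ≤ V₀` (`0 < V₀`), then `‖w(t,x)‖ ≤ 2V₀` for every `t ∈ (0,T₁]` with `64 C₁² V₀² t < 1`.
Proof verbatim the tree's `exists_norm_le_two_mul_of_window` (clamped lower-semicontinuous sup norm, Leray's Volterra
inequality, initial segment, strict constant supersolution `2V₀`, `volterra_sqrt_comparison`).
[cite: Leray1934, §21 (3.14)–(3.15) p. 226] [cite: OzanskiPooley2018, Lemma 6.23 (i) with Lemma 6.5] -/
theorem norm_le_two_mul_of_window_of_mild :
    ∃ C₁ : ℝ, 0 < C₁ ∧ ∀ {T₁ M V₀ : ℝ}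
      {w : ℝ → EuclideanSpace ℝ (Fin 3) → EuclideanSpace ℝ (Fin 3)},
      0 < T₁ → ContinuousOn (uncurry w) (Icc 0 T₁ ×ˢ univ) →
      (∀ s ∈ Ioc 0 T₁, ∀ x, w s x =
        UnboundedOperators.heatExtension (w 0) s x - oseenDuhamel 1 0 w w s x) →
      0 < M → (∀ s ∈ Icc 0 T₁, ∀ y, ‖w s y‖ ≤ M) →
      0 < V₀ → (∀ y, ‖w 0 y‖ ≤ V₀) →
      ∀ t ∈ Ioc 0 T₁, 64 * C₁ ^ 2 * V₀ ^ 2 * t < 1 → ∀ x, ‖w t x‖ ≤ 2 * V₀ := by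
  -- adapted from Literature/Analysis/FluidPDE/NSLerayBlowupRateTopHolds.lean (`exists_norm_le_two_mul_of_window`), ν = 1
  obtain ⟨C₁, hC₁, hA⟩ := norm_le_const_add_volterra_of_mild
  refine ⟨C₁, hC₁, ?_⟩
  intro T₁ M V₀ w hT₁ hcont₁ hmild hMpos hMb hV₀ hu₀ t ht htw x
  -- ### the clamped field and its sup norm `V`
  obtain ⟨cl, hcl_def⟩ : ∃ cl : ℝ → ℝ, cl = fun τ => max 0 (min τ T₁) := ⟨_, rfl⟩
  have hcl_mem : ∀ τ, cl τ ∈ Icc 0 T₁ := fun τ => by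
    rw [hcl_def]
    exact ⟨le_max_left _ _, max_le hT₁.le (min_le_right _ _)⟩
  have hcl_id : ∀ τ ∈ Icc 0 T₁, cl τ = τ := fun τ hτ => by
    rw [hcl_def]
    show max 0 (min τ T₁) = τ
    rw [min_eq_left hτ.2, max_eq_right hτ.1]
  have hcl_cont : Continuous cl := by
    rw [hcl_def]
    exact continuous_const.max (continuous_id.min continuous_const)
  obtain ⟨V, hV⟩ : ∃ V : ℝ → ℝ, V = fun τ => ⨆ y, ‖w (cl τ) y‖ := ⟨_, rfl⟩
  have hbddV : ∀ τ, BddAbove (range fun y => ‖w (cl τ) y‖) := fun τ =>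
    ⟨M, forall_mem_range.2 fun y => hMb _ (hcl_mem τ) y⟩
  have hVle : ∀ τ y, ‖w (cl τ) y‖ ≤ V τ := fun τ y => by
    rw [hV]
    exact le_ciSup (hbddV τ) y
  have hV0 : ∀ τ, 0 ≤ V τ := fun τ => (norm_nonneg _).trans (hVle τ 0)
  have hVM : ∀ τ, V τ ≤ M := fun τ => by
    rw [hV]
    exact ciSup_le fun y => hMb _ (hcl_mem τ) y
  have hVu : ∀ τ ∈ Icc 0 T₁, ∀ y, ‖w τ y‖ ≤ V τ := fun τ hτ y => by
    have h := hVle τ y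
    rwa [hcl_id τ hτ] at h
  have hVm : Measurable V := by
    have hcy : ∀ y : EuclideanSpace ℝ (Fin 3), Continuous fun τ : ℝ => ‖w (cl τ) y‖ := fun y => by
      have h1 : Continuous fun τ : ℝ => (cl τ, y) := hcl_cont.prodMk continuous_const
      exact (hcont₁.comp_continuous h1 fun τ => ⟨hcl_mem τ, mem_univ _⟩).norm
    rw [hV]
    exact (lowerSemicontinuous_ciSup
      (f := fun (y : EuclideanSpace ℝ (Fin 3)) (τ : ℝ) => ‖w (cl τ) y‖) hbddV
      fun y => (hcy y).lowerSemicontinuous).measurable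
  -- ### Leray's integral inequality for `V` on `(0, T₁]`
  have hVolt : ∀ s ∈ Ioc 0 T₁, V s ≤ V₀ +
      C₁ * ∫ τ in Ioo 0 s, (s - τ) ^ (-(1 / 2 : ℝ)) * V τ ^ 2 := by
    intro s hs
    have hsup := hA hT₁ hmild hMpos hVm hV0 hVM hVu hu₀ s hs
    have hVs : V s = ⨆ y, ‖w s y‖ := by
      rw [hV]
      show (⨆ y, ‖w (cl s) y‖) = ⨆ y, ‖w s y‖
      rw [hcl_id s ⟨hs.1.le, hs.2⟩]
    rw [hVs]
    exact ciSup_le hsup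
  -- integrability of the memory integrand and the crude bound `∫ ≤ M² · 2√s`
  have hkV : ∀ s : ℝ, IntegrableOn (fun τ => (s - τ) ^ (-(1 / 2 : ℝ)) * V τ ^ 2) (Ioo 0 s) := by
    intro s
    refine Integrable.mul_bdd (c := M ^ 2) (integrableOn_sub_rpow_Ioo (by norm_num))
      ((hVm.pow_const 2).aestronglyMeasurable) (Eventually.of_forall fun τ => ?_)
    rw [Real.norm_of_nonneg (sq_nonneg _)]
    exact pow_le_pow_left₀ (hV0 τ) (hVM τ) 2
  have hcrude : ∀ s : ℝ, 0 < s →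
      ∫ τ in Ioo 0 s, (s - τ) ^ (-(1 / 2 : ℝ)) * V τ ^ 2 ≤ M ^ 2 * (2 * Real.sqrt s) := by
    intro s hs
    have hk : IntegrableOn (fun τ : ℝ => (s - τ) ^ (-(1 / 2 : ℝ))) (Ioo 0 s) :=
      integrableOn_sub_rpow_Ioo (by norm_num)
    calc ∫ τ in Ioo 0 s, (s - τ) ^ (-(1 / 2 : ℝ)) * V τ ^ 2
        ≤ ∫ τ in Ioo 0 s, (s - τ) ^ (-(1 / 2 : ℝ)) * M ^ 2 := by
          refine setIntegral_mono_on (hkV s) (hk.mul_const _) measurableSet_Ioo fun τ hτ => ?_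
          exact mul_le_mul_of_nonneg_left (pow_le_pow_left₀ (hV0 τ) (hVM τ) 2)
            (Real.rpow_nonneg (sub_nonneg.2 hτ.2.le) _)
      _ = M ^ 2 * (2 * Real.sqrt s) := by
          rw [integral_mul_const, setIntegral_Ioo_sub_rpow_neg_half hs.le, sub_zero,
            ← Real.sqrt_eq_rpow, mul_comm]
  -- ### the initial segment: `V ≤ 2V₀` on `(0, δ]`, from the inequality itself
  set δ₀ : ℝ := (V₀ / (2 * C₁ * M ^ 2 + 1)) ^ 2 with hδ₀
  have hden : 0 < 2 * C₁ * M ^ 2 + 1 := by positivity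
  have hδ₀pos : 0 < δ₀ := by positivity
  set δ : ℝ := min T₁ δ₀ with hδ
  have hδpos : 0 < δ := lt_min hT₁ hδ₀pos
  have hinit : ∀ τ ∈ Ioc 0 δ, V τ ≤ 2 * V₀ := by
    intro τ hτ
    have hτT₁ : τ ≤ T₁ := hτ.2.trans (min_le_left _ _)
    have hτδ₀ : τ ≤ δ₀ := hτ.2.trans (min_le_right _ _)
    have hsq : Real.sqrt τ ≤ V₀ / (2 * C₁ * M ^ 2 + 1) := by
      calc Real.sqrt τ ≤ Real.sqrt δ₀ := Real.sqrt_le_sqrt hτδ₀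
        _ = V₀ / (2 * C₁ * M ^ 2 + 1) := Real.sqrt_sq (by positivity)
    have h1 : C₁ * (M ^ 2 * (2 * Real.sqrt τ)) ≤ V₀ := by
      calc C₁ * (M ^ 2 * (2 * Real.sqrt τ)) = 2 * C₁ * M ^ 2 * Real.sqrt τ := by ring
        _ ≤ 2 * C₁ * M ^ 2 * (V₀ / (2 * C₁ * M ^ 2 + 1)) :=
            mul_le_mul_of_nonneg_left hsq (by positivity)
        _ ≤ (2 * C₁ * M ^ 2 + 1) * (V₀ / (2 * C₁ * M ^ 2 + 1)) :=
            mul_le_mul_of_nonneg_right (by linarith) (by positivity)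
        _ = V₀ := by field_simp
    calc V τ ≤ V₀ + C₁ * ∫ σ in Ioo 0 τ, (τ - σ) ^ (-(1 / 2 : ℝ)) * V σ ^ 2 :=
          hVolt τ ⟨hτ.1, hτT₁⟩
      _ ≤ V₀ + C₁ * (M ^ 2 * (2 * Real.sqrt τ)) := by
          gcongr
          exact hcrude τ hτ.1
      _ ≤ V₀ + V₀ := by linarith
      _ = 2 * V₀ := by ring
  -- ### the strict supersolution `ψ ≡ 2V₀` on the window `(0, t]`
  have hψint : ∀ τ : ℝ, 0 < τ →
      ∫ σ in Ioo 0 τ, (τ - σ) ^ (-(1 / 2 : ℝ)) * (2 * V₀) ^ 2 =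
        (2 * V₀) ^ 2 * (2 * Real.sqrt τ) := by
    intro τ hτ
    rw [integral_mul_const, setIntegral_Ioo_sub_rpow_neg_half hτ.le, sub_zero, ← Real.sqrt_eq_rpow,
      mul_comm]
  have hψG : ∀ τ ∈ Ioc 0 t, V₀ + C₁ * ∫ σ in Ioo 0 τ, (τ - σ) ^ (-(1 / 2 : ℝ)) * (2 * V₀) ^ 2 ≤
      V₀ + C₁ * ((2 * V₀) ^ 2 * (2 * Real.sqrt τ)) := fun τ hτ => by rw [hψint τ hτ.1]
  have hGψ : ∀ τ ∈ Ioc 0 t, V₀ + C₁ * ((2 * V₀) ^ 2 * (2 * Real.sqrt τ)) < 2 * V₀ := by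
    intro τ hτ
    have h64 : 64 * C₁ ^ 2 * V₀ ^ 2 * τ < 1 := by
      have : 64 * C₁ ^ 2 * V₀ ^ 2 * τ ≤ 64 * C₁ ^ 2 * V₀ ^ 2 * t :=
        mul_le_mul_of_nonneg_left hτ.2 (by positivity)
      exact this.trans_lt htw
    have hsq : (8 * C₁ * V₀ * Real.sqrt τ) ^ 2 = 64 * C₁ ^ 2 * V₀ ^ 2 * τ := by
      rw [mul_pow, Real.sq_sqrt hτ.1.le]
      ring
    have h1 : 8 * C₁ * V₀ * Real.sqrt τ < 1 :=
      (sq_lt_one_iff₀ (by positivity)).1 (by rw [hsq]; exact h64)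
    have hid : C₁ * ((2 * V₀) ^ 2 * (2 * Real.sqrt τ)) = V₀ * (8 * C₁ * V₀ * Real.sqrt τ) := by ring
    rw [hid]
    have h3 := mul_lt_mul_of_pos_left h1 hV₀
    linarith
  have hGc : ContinuousOn (fun τ => V₀ + C₁ * ((2 * V₀) ^ 2 * (2 * Real.sqrt τ))) (Ioc 0 t) :=
    continuousOn_const.add (continuousOn_const.mul (continuousOn_const.mul
      (continuousOn_const.mul Real.continuous_sqrt.continuousOn)))
  have hψc : ContinuousOn (fun _ : ℝ => 2 * V₀) (Ioc 0 t) := continuousOn_const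
  have hψi : ∀ τ ∈ Ioc 0 t,
      IntegrableOn (fun σ => (τ - σ) ^ (-(1 / 2 : ℝ)) * (2 * V₀) ^ 2) (Ioo 0 τ) := fun τ _ =>
    (integrableOn_sub_rpow_Ioo (by norm_num)).mul_const _
  have hV' : ∀ τ ∈ Ioc 0 t,
      V τ ≤ V₀ + C₁ * ∫ σ in Ioo 0 τ, (τ - σ) ^ (-(1 / 2 : ℝ)) * V σ ^ 2 := fun τ hτ =>
    hVolt τ ⟨hτ.1, hτ.2.trans ht.2⟩
  -- ### the comparison principle
  have hcomp := volterra_sqrt_comparison (V := V) (ψ := fun _ => 2 * V₀)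
    (G := fun τ => V₀ + C₁ * ((2 * V₀) ^ 2 * (2 * Real.sqrt τ))) (a := fun _ => V₀) (C := C₁)
    (M := M) (t₁ := t) (δ := δ) hC₁.le hδpos hVm (fun τ _ => hV0 τ) (fun τ _ => hVM τ) hV' hψG hGψ
    hGc hψc hψi hinit
  exact (hVu t ⟨ht.1.le, ht.2⟩ x).trans (hcomp t ⟨ht.1, le_rfl⟩)

/-! ### T4: Leray's floor at a singular apex of a Type-I ancient mild field -/

/-- **T4 of line `truncation_edge` — LERAY'S RATE FLOOR AT THE SINGULAR APEX, KNSS gauge** (the body of the line object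
`RateFloor v`, unfolded): if `v` is a Type-I ancient mild field (`IsTypeIAncientMild M v`) singular at the origin at time
`0` (`SingularAt v 0`), then with the UNIVERSAL `c = (16 C₁)⁻¹ > 0` every slice `s ∈ [−1, 0)` carries a point `x` with
`c/√(−s) ≤ ‖v(s,x)‖`.  Otherwise `‖v(s₀,·)‖ < c/√(−s₀) =: V₀`, the translate `w(τ) = v(τ + s₀)` is Oseen-mild from time `0`
on `[0, t − s₀]` for every `t < 0` (`mild_eq_heatExtension`, `oseenDuhamel_comp_sub_right`), bounded there by the Type-I
bound, and `64 C₁² V₀² (t − s₀) < 64 C₁² c² = 1/4`, so `norm_le_two_mul_of_window_of_mild` bounds `v` by `2V₀` on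
`(s₀, 0) × ℝ³` — contradicting `SingularAt v 0` at radius `r = √(−s₀)`.
[cite: Leray1934, §19 (3.9) p. 224] [cite: KochNadirashviliSereginSverak2009, §4 p. 8 (the L^∞ mild class)] -/
theorem rateFloor_of_isTypeIAncientMild_of_singularAt :
    ∃ c : ℝ, 0 < c ∧ ∀ (M : ℝ) (v : ℝ → EuclideanSpace ℝ (Fin 3) → EuclideanSpace ℝ (Fin 3)),
      IsTypeIAncientMild M v → SingularAt v 0 →
      ∀ s ∈ Set.Ico (-1 : ℝ) 0, ∃ x : EuclideanSpace ℝ (Fin 3), c / Real.sqrt (-s) ≤ ‖v s x‖ := by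
  obtain ⟨C₁, hC₁, hwin⟩ := norm_le_two_mul_of_window_of_mild
  refine ⟨(16 * C₁)⁻¹, by positivity, ?_⟩
  intro M v hv hsing s₀ hs₀
  by_contra hno
  push Not at hno
  have hs₀0 : s₀ < 0 := hs₀.2
  have hns₀ : 0 < -s₀ := by linarith
  set V₀ : ℝ := (16 * C₁)⁻¹ / Real.sqrt (-s₀) with hV₀
  have hV₀pos : 0 < V₀ := by positivity
  have hv₀ : ∀ y, ‖v s₀ y‖ ≤ V₀ := fun y => (hno y).le
  -- ### the doubling bound on `(s₀, 0) × ℝ³`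
  have hbound : ∀ t ∈ Ioo s₀ 0, ∀ x, ‖v t x‖ ≤ 2 * V₀ := by
    intro t ht x
    set T₁ : ℝ := t - s₀ with hT₁
    have hT₁pos : 0 < T₁ := by rw [hT₁]; linarith [ht.1]
    -- the translate `w τ = v (τ + s₀)` on `[0, T₁]`
    set w : ℝ → EuclideanSpace ℝ (Fin 3) → EuclideanSpace ℝ (Fin 3) := fun τ => v (τ + s₀) with hw
    have hw0 : w 0 = v s₀ := by simp [hw]
    have hneg : ∀ τ ∈ Icc 0 T₁, τ + s₀ < 0 := fun τ hτ => by rw [hT₁] at hτ; linarith [hτ.2, ht.2]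
    -- joint continuity on the closed strip
    have hcont : ContinuousOn (uncurry w) (Icc 0 T₁ ×ˢ univ) := by
      have hφ : Continuous fun q : ℝ × EuclideanSpace ℝ (Fin 3) => (q.1 + s₀, q.2) :=
        (continuous_fst.add continuous_const).prodMk continuous_snd
      have hmaps : MapsTo (fun q : ℝ × EuclideanSpace ℝ (Fin 3) => (q.1 + s₀, q.2))
          (Icc 0 T₁ ×ˢ univ) (Iio 0 ×ˢ univ) := fun q hq => ⟨hneg q.1 hq.1, mem_univ _⟩
      have h := hv.continuousOn_uncurry.comp hφ.continuousOn hmaps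
      refine h.congr fun q _ => ?_
      simp [hw, uncurry]
    -- the Type-I bound on the strip
    set Mb : ℝ := max (M / Real.sqrt (-t)) 1 with hMb
    have hMbpos : 0 < Mb := lt_max_of_lt_right one_pos
    have hMbd : ∀ τ ∈ Icc 0 T₁, ∀ y, ‖w τ y‖ ≤ Mb := by
      intro τ hτ y
      have hτ0 : τ + s₀ < 0 := hneg τ hτ
      have hle : τ + s₀ ≤ t := by rw [hT₁] at hτ; linarith [hτ.2]
      have hM0 : 0 ≤ M := hv.nonneg
      calc ‖w τ y‖ = ‖v (τ + s₀) y‖ := rfl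
        _ ≤ M / Real.sqrt (-(τ + s₀)) := hv.norm_le hτ0 y
        _ ≤ M / Real.sqrt (-t) :=
            div_le_div_of_nonneg_left hM0 (Real.sqrt_pos.2 (by linarith [ht.2]))
              (Real.sqrt_le_sqrt (by linarith))
        _ ≤ Mb := le_max_left _ _
    -- the mild identity from time `0`
    have hmild : ∀ s ∈ Ioc 0 T₁, ∀ x, w s x =
        UnboundedOperators.heatExtension (w 0) s x - oseenDuhamel 1 0 w w s x := by
      intro s hs x
      have hs0 : s₀ < s + s₀ := by linarith [hs.1]
      have hss : s + s₀ < 0 := hneg s ⟨hs.1.le, hs.2⟩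
      have h1 := hv.mild_eq_heatExtension hs0 hss x
      have hB : oseenDuhamel 1 0 w w s x = oseenDuhamel 1 s₀ v v (s + s₀) x := by
        have e : w = fun τ => v (τ - (-s₀)) := by
          funext τ
          simp [hw, sub_neg_eq_add]
        rw [e, oseenDuhamel_comp_sub_right]
        congr 1 <;> ring
      rw [hB, hw0]
      show v (s + s₀) x = _
      rw [h1, add_sub_cancel_right]
    -- the window: `64 C₁² V₀² T₁ < 64 C₁² V₀² (-s₀) = 1/4 < 1`
    have hwin' : 64 * C₁ ^ 2 * V₀ ^ 2 * T₁ < 1 := by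
      have hV₀sq : V₀ ^ 2 * (-s₀) = ((16 * C₁)⁻¹) ^ 2 := by
        rw [hV₀, div_pow, Real.sq_sqrt hns₀.le, div_mul_cancel₀ _ hns₀.ne']
      have hT₁lt : T₁ < -s₀ := by rw [hT₁]; linarith [ht.2]
      calc 64 * C₁ ^ 2 * V₀ ^ 2 * T₁ < 64 * C₁ ^ 2 * V₀ ^ 2 * (-s₀) :=
            mul_lt_mul_of_pos_left hT₁lt (by positivity)
        _ = 64 * C₁ ^ 2 * ((16 * C₁)⁻¹) ^ 2 := by rw [mul_assoc, hV₀sq]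
        _ = 1 / 4 := by
            have hC₁ne : C₁ ≠ 0 := hC₁.ne'
            field_simp
            ring
        _ < 1 := by norm_num
    have hv₀' : ∀ y, ‖w 0 y‖ ≤ V₀ := fun y => by rw [hw0]; exact hv₀ y
    have h := hwin hT₁pos hcont hmild hMbpos hMbd hV₀pos hv₀' T₁ ⟨hT₁pos, le_rfl⟩ hwin' x
    have e : w T₁ x = v t x := by simp [hw, hT₁]
    rwa [e] at h
  -- ### contradiction with the singularity at the origin
  obtain ⟨t, ht, y, -, hgt⟩ := hsing (Real.sqrt (-s₀)) (Real.sqrt_pos.2 hns₀) (2 * V₀)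
  rw [Real.sq_sqrt hns₀.le, neg_neg] at ht
  exact absurd (hbound t ht y) (not_le.2 hgt)

end Summit.NavierStokesRegularity.NavierStokesRegularity.Cruxes.TypeIQuantSubcubicExp.TruncationEdge

end
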